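/-
Copyright (c) 2026. All rights reserved.
Released under Apache 2.0 license as described in the file LICENSE.
-/
import Literature.Computability.QuantumComplexity.GRBlockWordFP
import Literature.Computability.QuantumComplexity.GRBlockWordCapFP

/-!
# The cosine/table samplers' Grover–Rudolph block word on codes, outright

With the usable (unary-indexed) form `GRBlockWordCapFP.levelsA_codeFP_cap` and the standard block word
`GRBlockWordFP.blockAN`: `blockAN_congr`, and — plugging the cosine suffixes (the general usable recipe is
`GRBlockWordCapFP.levelsA_codeFP_cap` with `GRData.insVals_codeFP_of` and the `GRKitPlugFP`/`GRDataPosFP` inputs, as in the proof below)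
`GRBlockWordCapFP.suffix_codeFP_of` / `suffixN_codeFP_of` — **`blockAN_cos_codeFP_of`**: the cosine/table samplers'
Grover–Rudolph block word on codes with NO hypothesis beyond the four unary sizes; and the bridge
**`GRTableMach.map_toAG_blockCircuit_data`**: the block circuit of `GRTableMach.data τ S p U k ℓ np hnp` IS
`blockAN (cosE τ) (cosM τ) ℓ np (wlen τ ℓ np) (k+1) (GRCosineMach.v np)`.

HONEST FRAMING: the VALUE is a THEOREM (kernel-checked lemmas of a KNOWN reduction, Regev 2009) — NOT summit progress.
-/

noncomputable section

namespace Literature.Computability.QuantumComplexity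

open _root_.Computability Cryptography Complexity Complexity.CodeFP SLP RevDesc AJLCore RevSim RevClean CleanPlaced Turing

variable {σ : Type} {eσ : σ → List Bool}

namespace GRStage

variable {e : ℕ} {M : TM2ComputableAux Bool Bool}

/-- The block word depends on the suffix function only below `ℓ`. [folklore] [cite: AroraBarak2009, §6.2 (proof of Thm. 6.15)] -/
theorem blockAN_congr (e : ℕ) (M : TM2ComputableAux Bool Bool) (ℓ np wlen kk : ℕ) {v v' : ℕ → List Bool}
    (h : ∀ j < ℓ, v j = v' j) : blockAN e M ℓ np wlen kk v = blockAN e M ℓ np wlen kk v' :=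
  List.flatMap_congr fun j hj => by unfold levelAN insStd; rw [h j (List.mem_range.1 hj)]


/-- **The cosine/table samplers' Grover–Rudolph block word on codes**, from the four sizes in unary.
[cite: Regev2009, Lemma 3.12 (proof), Lemma 3.14 (proof)] [cite: AroraBarak2009, §6.2 (proof of Thm. 6.15)] -/
theorem blockAN_cos_codeFP_of (e : ℕ) (M : TM2ComputableAux Bool Bool) {ℓ np wlen kk : σ → ℕ}
    (hℓ : CodeFP eσ unE ℓ) (hnp : CodeFP eσ unE np) (hwlen : CodeFP eσ unE wlen) (hk : CodeFP eσ unE kk) :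
    CodeFP eσ (rawE agE0) (fun c => blockAN e M (ℓ c) (np c) (wlen c) (kk c) (GRCosineMach.v (np c))) := by
  have hv : CodeFP (pairE eσ unE) strE (fun q => GRCosineMach.v (np q.1) q.2) := suffix_codeFP_of hnp
  have hN : CodeFP (pairE eσ unE) unE (fun q => q.2 + np q.1 + (GRCosineMach.v (np q.1) q.2).length) := suffixN_codeFP_of hnp
  have hd : CodeFP eσ unE (fun c => ℓ c + np c + wlen c) := BP.uadd (BP.uadd hℓ hnp) hwlen
  have hins : CodeFP (pairE eσ unE) (rawE natE) (fun q => insStd e M (ℓ q.1) (np q.1) (kk q.1) (GRCosineMach.v (np q.1)) q.2) :=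
    (GRData.insVals_codeFP_of e M (j := fun q => q.2) (v := fun q => GRCosineMach.v (np q.1) q.2) (BP.toNat (snd _ _)) (hℓ.comp (fst _ _))
      (hnp.comp (fst _ _)) (hk.comp (fst _ _)) hN :)
  have hbase : CodeFP eσ natE (fun c => ℓ c + np c) := GRData.baseStd_codeFP_of hℓ hnp
  have hcr : CodeFP eσ natE (fun c => (GenKit.gpOf (GRData.ps (kk c)) (ℓ c + np c + wlen c) (kk c)).cr) := (GenKit.crA_codeFP_of hd hk :)
  have hdpos : CodeFP (pairE (pairE eσ unE) natE) natE (fun q => GRData.dposStd (ℓ q.1.1) (np q.1.1) q.1.2 q.2) :=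
    ((GRData.dposStd_codeFP_of hℓ hnp).comp ((((fst _ _).comp (fst _ _)).pair (BP.toNat ((snd _ _).comp (fst _ _)))).pair (snd _ _)) :)
  have ht : CodeFP (pairE eσ unE) natE (fun q => q.2) := BP.toNat (snd _ _)
  have hflag : CodeFP (pairE eσ unE) natE (fun q => (GenKit.gpOf (GRData.ps (kk q.1)) (ℓ q.1 + np q.1 + wlen q.1) (kk q.1)).gflagA (progGR (kk q.1))) :=
    ((GenKit.grFlagA_codeFP_of hd hk).comp (fst _ _) :)
  have hgops : CodeFP (pairE eσ unE) (rawE clopE) (fun q => (GenKit.gpOf (GRData.ps (kk q.1)) (ℓ q.1 + np q.1 + wlen q.1) (kk q.1)).gopsA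
      (insStd e M (ℓ q.1) (np q.1) (kk q.1) (GRCosineMach.v (np q.1)) q.2) (progGR (kk q.1))) :=
    (GenKit.grOpsA_codeFP_of (ins := fun c j => insStd e M (ℓ c) (np c) (kk c) (GRCosineMach.v (np c)) j) hd hk hins :)
  have hhad : CodeFP eσ (rawE natE) (fun c => (GenKit.gpOf (GRData.ps (kk c)) (ℓ c + np c + wlen c) (kk c)).cr ::
      (GenKit.gpOf (GRData.ps (kk c)) (ℓ c + np c + wlen c) (kk c)).as) := (GenKit.hadA_codeFP_of hd hk :)
  have hasreg : CodeFP eσ (rawE natE) (fun c => (GenKit.gpOf (GRData.ps (kk c)) (ℓ c + np c + wlen c) (kk c)).as ++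
      (GenKit.gpOf (GRData.ps (kk c)) (ℓ c + np c + wlen c) (kk c)).region) := (GenKit.asRegionA_codeFP_of hd hk :)
  have hhs : CodeFP eσ (rawE natE) (fun c => (GenKit.gpOf (GRData.ps (kk c)) (ℓ c + np c + wlen c) (kk c)).hs) := (GenKit.hsA_codeFP_of hd hk :)
  have H := levelsA_codeFP_cap (e := e) (M := M) (ℓ := ℓ) (np := np) (base := fun c => ℓ c + np c)
    (cr := fun c => (GenKit.gpOf (GRData.ps (kk c)) (ℓ c + np c + wlen c) (kk c)).cr) (v := fun c j => GRCosineMach.v (np c) j)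
    (dpos := fun c j i => GRData.dposStd (ℓ c) (np c) j i) (t := fun _ j => j)
    (had := fun c => (GenKit.gpOf (GRData.ps (kk c)) (ℓ c + np c + wlen c) (kk c)).cr :: (GenKit.gpOf (GRData.ps (kk c)) (ℓ c + np c + wlen c) (kk c)).as)
    (asreg := fun c => (GenKit.gpOf (GRData.ps (kk c)) (ℓ c + np c + wlen c) (kk c)).as ++ (GenKit.gpOf (GRData.ps (kk c)) (ℓ c + np c + wlen c) (kk c)).region)
    (hs := fun c => (GenKit.gpOf (GRData.ps (kk c)) (ℓ c + np c + wlen c) (kk c)).hs)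
    (flag := fun c _ => (GenKit.gpOf (GRData.ps (kk c)) (ℓ c + np c + wlen c) (kk c)).gflagA (progGR (kk c)))
    (gops := fun c j => (GenKit.gpOf (GRData.ps (kk c)) (ℓ c + np c + wlen c) (kk c)).gopsA (insStd e M (ℓ c) (np c) (kk c) (GRCosineMach.v (np c)) j) (progGR (kk c)))
    hℓ (BP.toNat hnp) hbase hcr hv hN hdpos ht hflag hgops hhad hasreg hhs
  unfold blockAN levelAN
  exact H


end GRStage

namespace GRTableMach

/-- **The table sampler's Grover–Rudolph block circuit is the standard block word** with the cosine machine and the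
suffixes `1ʲ 0 1^{j+np+1}`. [cite: Regev2009, Lemma 3.12 (proof), Lemma 3.14 (proof)] -/
theorem map_toAG_blockCircuit_data (τ : LevelCode) (S : ℚ) (p U k ℓ np : ℕ) (hnp : (GRCosineMach.pcode ((S, (p, U)), (k, ℓ))).length ≤ np) :
    (GRStage.blockCircuit (kit := GenKit.kit (GRData.ps (k + 1)) (ℓ + np + wlen τ ℓ np) (k + 1)) (data τ S p U k ℓ np hnp)).gates.map toAG =
      GRStage.blockAN (cosE τ) (cosM τ) ℓ np (wlen τ ℓ np) (k + 1) (GRCosineMach.v np) := by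
  rw [data, GRStage.map_toAG_blockCircuit_data]
  exact GRStage.blockAN_congr _ _ _ _ _ _ fun j hj => by rw [GRStage.vN, dif_pos hj]; rfl

end GRTableMach

end Literature.Computability.QuantumComplexity

end
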